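import Summits.CriticalPhenomena.CardyFormulaZ2.Theses.CardyMonotoneApproach
import Literature.Probability.Percolation.RSWProofs
import HarnessLib

/-!
# Strategy census (Lean side) for the crux `CardyMonotoneApproach.MonotoneApproach`
(item `stmt-CriticalPhenomena-5844`, route `route-CriticalPhenomena-CardyMonotoneApproach`, sub-problem
`CardyFormulaZ2`; redirect crux-strategist r1, 2026-08-17).

Sorry-free typed artefacts quoted in `Cruxes/MonotoneApproach/STRATEGY-CENSUS.md`:

* `BoxLimitExists` — what the route actually CONSUMES from the crux (RectGlue step (i)): the exact
  box-crossing sequences `a(p,q,n) := crossingProb half (p*n+1) (q*n)` converge.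
* `boxLimitExists_of_monotoneApproach : MonotoneApproach → BoxLimitExists` — the whole downstream use of
  Conjecture M is this one-line corollary (eventually monotone + values in `[0,1]` ⇒ convergent).  The
  converse is not claimed (and is false for general sequences): the SURPLUS of M over its deliverable is
  the eventual sign of the increments `a(p,q,n+1) − a(p,q,n)`, i.e. the sign of the leading finite-size
  correction — a corrections-to-scaling statement.
* `StrongWideAntitone` — the rigid ("all n") strengthening S⁺ examined under `## Strengthen`, and
  `monotoneApproach_of_strongWideAntitone : StrongWideAntitone → MonotoneApproach` (exact duality and the
  self-dual diagonal reduce M to the wide side `q < p`).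
* `WideEventualAntitone` / `monotoneApproach_of_wideEventualAntitone` — the directed eventual form the exact
  layer supports (wide boxes: decreasing), which also implies M.

No `sorry`; axioms = propext / Classical.choice / Quot.sound.
-/

noncomputable section

namespace Summit.CriticalPhenomena.CardyFormulaZ2.Cruxes.MonotoneApproach.StrategyCensus

open Filter Topology
open Literature.Probability.Percolation (crossingProb half symm_half crossingProb_mem_Icc
  crossingProb_half_succ_self_holds crossingProb_add_crossingProb_symm_holds)
open Summit.CriticalPhenomena.CardyFormulaZ2.Theses.CardyMonotoneApproach (MonotoneApproach)

/-! ### The deliverable: existence of the box-crossing limits -/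

/-- `BoxLimitExists`: for all `p, q ≥ 1` the exact box-crossing probabilities
`a(p,q,n) = P_½(LR([0,pn+1]×[0,qn])) = crossingProb half (p*n+1) (q*n)` converge as `n → ∞`.
This is the ONLY consequence of `MonotoneApproach` the route's glue (`RectGlue` (i)) uses. -/
def BoxLimitExists : Prop :=
  ∀ p q : ℕ, 1 ≤ p → 1 ≤ q →
    ∃ L : ℝ, Tendsto (fun n : ℕ => crossingProb half (p * n + 1) (q * n)) atTop (𝓝 L)

/-- A real sequence with values in `[0,1]` that is monotone or antitone on a tail `Set.Ici N` converges. -/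
theorem exists_tendsto_of_monotoneOn_or_antitoneOn_Ici {f : ℕ → ℝ} {N : ℕ}
    (hb : ∀ n, f n ∈ Set.Icc (0:ℝ) 1)
    (h : MonotoneOn f (Set.Ici N) ∨ AntitoneOn f (Set.Ici N)) :
    ∃ L : ℝ, Tendsto f atTop (𝓝 L) := by
  have hmem : ∀ k : ℕ, k + N ∈ Set.Ici N := fun k => Set.mem_Ici.mpr (Nat.le_add_left N k)
  have hup : BddAbove (Set.range fun k : ℕ => f (k + N)) := by
    refine ⟨1, ?_⟩
    rintro _ ⟨k, rfl⟩
    exact (hb (k + N)).2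
  have hlow : BddBelow (Set.range fun k : ℕ => f (k + N)) := by
    refine ⟨0, ?_⟩
    rintro _ ⟨k, rfl⟩
    exact (hb (k + N)).1
  rcases h with hmono | hanti
  · have hg : Monotone fun k : ℕ => f (k + N) :=
      fun a b hab => hmono (hmem a) (hmem b) (Nat.add_le_add_right hab N)
    exact ⟨_, (Filter.tendsto_add_atTop_iff_nat N).mp (tendsto_atTop_ciSup hg hup)⟩
  · have hg : Antitone fun k : ℕ => f (k + N) :=
      fun a b hab => hanti (hmem a) (hmem b) (Nat.add_le_add_right hab N)
    exact ⟨_, (Filter.tendsto_add_atTop_iff_nat N).mp (tendsto_atTop_ciInf hg hlow)⟩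

/-- **The route's entire use of Conjecture M.** `MonotoneApproach → BoxLimitExists`
(eventually monotone + `crossingProb ∈ [0,1]` ⇒ convergent). -/
theorem boxLimitExists_of_monotoneApproach (hM : MonotoneApproach) : BoxLimitExists := by
  intro p q hp hq
  obtain ⟨N, hN⟩ := hM p q hp hq
  exact exists_tendsto_of_monotoneOn_or_antitoneOn_Ici (fun n => crossingProb_mem_Icc half _ _) hN

/-! ### Exact identities of the box family -/

/-- Exact duality of the box family: `a(p,q,n) + a(q,p,n) = 1`. -/
theorem boxSeq_add_boxSeq_swap (p q n : ℕ) :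
    crossingProb half (p * n + 1) (q * n) + crossingProb half (q * n + 1) (p * n) = 1 := by
  have h := crossingProb_add_crossingProb_symm_holds half (p * n) (q * n)
  rwa [symm_half] at h

/-- The self-dual diagonal: `a(p,p,n) = 1/2`. -/
theorem boxSeq_diag (p n : ℕ) : crossingProb half (p * n + 1) (p * n) = 1 / 2 :=
  crossingProb_half_succ_self_holds (p * n)

/-! ### S⁺ (Strengthen): the rigid all-`n` form on the wide side, and the directed eventual form -/

/-- `StrongWideAntitone` (S⁺): for `1 ≤ q < p` the wide-box sequence `n ↦ a(p,q,n)` is antitone for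
ALL `n` (no threshold).  Every instance `a(p,q,n+1) ≤ a(p,q,n)` is a finite, decidable inequality between
dyadic rationals; the exact layer (STRATEGY-CENSUS.md §Negation) verifies it in its whole range. -/
def StrongWideAntitone : Prop :=
  ∀ p q : ℕ, 1 ≤ q → q < p → Antitone fun n : ℕ => crossingProb half (p * n + 1) (q * n)

/-- `WideEventualAntitone`: the directed eventual form on the wide side (`q < p`: eventually
non-increasing), which the physics (positive, decaying leading correction for hard-way crossings) predicts. -/
def WideEventualAntitone : Prop :=
  ∀ p q : ℕ, 1 ≤ q → q < p →
    ∃ N : ℕ, AntitoneOn (fun n : ℕ => crossingProb half (p * n + 1) (q * n)) (Set.Ici N)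

/-- The wide side decides M: exact duality transports an eventual (anti)tone wide sequence to the tall
side with the direction reversed, and the diagonal is constant. -/
theorem monotoneApproach_of_wideEventualAntitone (h : WideEventualAntitone) : MonotoneApproach := by
  intro p q hp hq
  rcases lt_trichotomy q p with hlt | heq | hgt
  · obtain ⟨N, hN⟩ := h p q hq hlt
    exact ⟨N, Or.inr hN⟩
  · subst heq
    refine ⟨0, Or.inl ?_⟩
    intro a _ b _ _
    show crossingProb half (q * a + 1) (q * a) ≤ crossingProb half (q * b + 1) (q * b)
    simp only [boxSeq_diag, le_refl]
  · obtain ⟨N, hN⟩ := h q p hp hgt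
    refine ⟨N, Or.inl ?_⟩
    intro a ha b hb hab
    have e₁ := boxSeq_add_boxSeq_swap p q a
    have e₂ := boxSeq_add_boxSeq_swap p q b
    have := hN ha hb hab
    show crossingProb half (p * a + 1) (q * a) ≤ crossingProb half (p * b + 1) (q * b)
    linarith

/-- S⁺ ⇒ the directed eventual form (threshold `0`). -/
theorem wideEventualAntitone_of_strong (h : StrongWideAntitone) : WideEventualAntitone :=
  fun p q hq hlt => ⟨0, (h p q hq hlt).antitoneOn _⟩

/-- S⁺ ⇒ M. -/
theorem monotoneApproach_of_strongWideAntitone (h : StrongWideAntitone) : MonotoneApproach :=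
  monotoneApproach_of_wideEventualAntitone (wideEventualAntitone_of_strong h)

end Summit.CriticalPhenomena.CardyFormulaZ2.Cruxes.MonotoneApproach.StrategyCensus

end
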